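import Summits.RiemannHypothesis.RiemannHypothesis.Theorems.TiltedLandingLaw421R3SinkThinSig
import Summits.RiemannHypothesis.RiemannHypothesis.Theorems.TiltedLandingLaw421R3SinkCorner
noncomputable section

/-! # «MenuThin» — the PRODUCER-SIDE per-datum one-read certificate law on the THIN far strip, menu {A, Ti} (β′ edit-list item E5, (CA1117))

W09 · C4 «kernel desk» rh-idea-6 g45 (files-only seat).  SUPPORT on the (β′) RESTATE programme behind `⟨33346⟩`: the thin twin of 142 «SinkCertLink» over C1's
E2 text of record `RhW08.SinkThin.CertificatesExist(Right)ThinSig`.  §1 the two ONE-CUT reads of C3 g58's MENU (RESULT-2, bus l.4208): the FOOT read at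
`p₀ = xv + i·Im w` in the datum-determined RULE-A direction `e_A = −K/‖K‖` (`K = farPairK v w = 1/(w − v) + 1/(w − v̄)` the datum kernel) and the TOP read at
`p₁ = xv + i·h` in direction `−i`; admissibility; certified levels at the read value `G = −mult·K` in closed form: `L_A = mult·(‖K‖ − σ·Im K)`,
`L_Ti = mult·(1 − σ)·Im K`.  §2 the MENU LAW `MenuThinSig lam` ⊇ `MenuThinRightSig lam` (OPEN, conjecture-shaped; C3's kit job «rh33346-thincert» certifies the
right real form at `lam² = 5/4` in interval arithmetic — a design input, not a proof): for every legal thin datum (C1's binders VERBATIM, lid read at its MAXIMAL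
height `Hs := R/2 − h` of E1′) ONE menu member certifies (K∂_thin) ∧ (D) for SOME `σ`; the ★★ LINKS `LemmaHThinSig → MenuThin(Right)Sig lam →
CertificatesExist(Right)ThinSig lam` (every lid `0 ≤ Hs`, `2·(Hs + h) ≤ R`, by antitonicity; witnesses `n = 1`).  §3 the right law AS A STATEMENT ABOUT REAL
RATIONAL FUNCTIONS in 110's coordinates (`δ = Re w − xv`, `t = Im w`, `Y = Im v`, `ξ = Re u − xv`, `b = Im u`): `MenuThinRightRealSig lam`, `menuThinRightSig_iff`.
NOT HERE: thin Lemma H (`LemmaHThinSig`; proved by C1 as `RhW08.SinkThin.lemmaHThin`, «SinkLemmaHThin»); any proof of the menu law; the consumer side (C1);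
the `R = 2` normal form («MenuThinNF», FILE 2).  Nothing in this file bears on the truth of RH; RH is NOT proved; `⟨33346⟩`/`⟨33347⟩` stay OPEN. -/

namespace RhW08.MenuThin

open Complex
open scoped ComplexConjugate
open RhW08.SinkTemplate RhW08.SinkBdry RhW08.SinkCorner RhW08.SinkThin

/-! ## §1 The two one-cut reads of the menu and their certified levels -/

/-- the ONE-cut family reading at the point `p` in direction `e`, weight `1`. -/
def oneCut (p e : ℂ) : Fin 1 → Cut := ![⟨p, e, 1⟩]

/-- RULE A: the foot direction `e_A = −K/‖K‖` determined by the datum kernel `K` (so that `Re(conj e_A · (−K)) = ‖K‖`). -/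
def ruleADir (K : ℂ) : ℂ := -(K / (‖K‖ : ℂ))

/-- menu member A: the rule-A FOOT read of the datum `(v, w)` at `p₀ = xv + i·Im w`. -/
def footA (xv : ℝ) (v w : ℂ) : Fin 1 → Cut := oneCut ⟨xv, w.im⟩ (ruleADir (farPairK v w))

/-- menu member Ti: the TOP read at `p₁ = xv + i·h` in direction `−i` (it reads `Im G(p₁)`). -/
def topI (xv h : ℝ) : Fin 1 → Cut := oneCut ⟨xv, h⟩ (-I)

/-- a one-cut read at a point on the line `Re = xv` with a unit direction is an admissible cut family. -/
theorem oneCut_admissible {xv : ℝ} {p e : ℂ} (hp : p.re = xv) (he : ‖e‖ = 1) : CutsAdmissible xv (oneCut p e) := by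
  unfold CutsAdmissible oneCut
  refine ⟨fun k => ?_, by rw [Fin.sum_univ_one, Matrix.cons_val_fin_one]⟩
  rw [Matrix.cons_val_fin_one]
  exact ⟨zero_le_one, he, hp⟩
/-- the reading point of a one-cut family. -/
theorem oneCut_p (p e : ℂ) : ∀ k, (oneCut p e k).p = p := fun k => by rw [oneCut, Matrix.cons_val_fin_one]

/-- member A reads at `xv + i·Im w` (first of the two points E2 allows). -/
theorem footA_pts (xv h : ℝ) (v w : ℂ) : ∀ k, (footA xv v w k).p = ⟨xv, w.im⟩ ∨ (footA xv v w k).p = ⟨xv, h⟩ :=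
  fun k => Or.inl (oneCut_p _ _ k)
/-- member Ti reads at `xv + i·h` (second of the two points E2 allows). -/
theorem topI_pts (xv h : ℝ) (w : ℂ) : ∀ k, (topI xv h k).p = ⟨xv, w.im⟩ ∨ (topI xv h k).p = ⟨xv, h⟩ :=
  fun k => Or.inr (oneCut_p _ _ k)

/-- the numerator of a one-cut read: `N(u) = Re(conj e · (K_u(w) − K_u(p)))`. -/
theorem cutNumer_oneCut (p e w u : ℂ) : cutNumer (oneCut p e) w u = (conj e * (farPairK u w - farPairK u p)).re := by
  unfold cutNumer oneCut
  simp only [Fin.sum_univ_one, Matrix.cons_val_fin_one, one_mul]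

/-- the certified level of a one-cut read: `L_cert = Re(conj e · G) + σ·Im G`. -/
theorem lcert_oneCut (p e G : ℂ) (σ : ℝ) : Lcert (oneCut p e) G σ = (conj e * G).re + σ * G.im := by
  unfold Lcert oneCut
  simp only [Fin.sum_univ_one, Matrix.cons_val_fin_one, one_mul]
  ring

/-- the rule-A direction is a unit vector (`K ≠ 0`). -/
theorem norm_ruleADir {K : ℂ} (hK : K ≠ 0) : ‖ruleADir K‖ = 1 := by
  unfold ruleADir; simp [norm_ne_zero_iff.2 hK]

/-- reading in the rule-A direction: `Re(conj e_A · G) = −(Re K·Re G + Im K·Im G)/‖K‖`. -/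
theorem conj_ruleADir_mul_re (K G : ℂ) : (conj (ruleADir K) * G).re = -((K.re * G.re + K.im * G.im) / ‖K‖) := by
  unfold ruleADir
  rw [map_neg, neg_mul, Complex.neg_re, Complex.mul_re, Complex.conj_re, Complex.conj_im, Complex.div_ofReal_re, Complex.div_ofReal_im]
  ring

/-- `((Re K)² + (Im K)²)/‖K‖ = ‖K‖` (also for `K = 0`). -/
theorem re_sq_add_im_sq_div_norm (K : ℂ) : (K.re * K.re + K.im * K.im) / ‖K‖ = ‖K‖ := by
  rw [← Complex.normSq_apply, ← Complex.sq_norm, pow_two, mul_self_div_self]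

/-- the certified level of a rule-A read at the read value `G = −mult·K`, any point `p`: `mult·(‖K‖ − σ·Im K)`. -/
theorem lcert_oneCut_ruleADir (p K : ℂ) (mult : ℕ) (σ : ℝ) :
    Lcert (oneCut p (ruleADir K)) (-((mult : ℂ) * K)) σ = mult * (‖K‖ - σ * K.im) := by
  rw [lcert_oneCut, conj_ruleADir_mul_re]
  simp only [Complex.neg_re, Complex.neg_im, Complex.mul_re, Complex.mul_im, Complex.natCast_re, Complex.natCast_im, zero_mul, sub_zero,
    add_zero]
  linear_combination (mult : ℝ) * re_sq_add_im_sq_div_norm K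

/-- ★ the certified level of the RULE-A FOOT read at `G = −mult·K`, `K` the datum kernel: `L_A = mult·(‖K‖ − σ·Im K)`. -/
theorem lcert_footA (xv : ℝ) (v w : ℂ) (mult : ℕ) (σ : ℝ) :
    Lcert (footA xv v w) (-((mult : ℂ) * farPairK v w)) σ = mult * (‖farPairK v w‖ - σ * (farPairK v w).im) :=
  lcert_oneCut_ruleADir _ (farPairK v w) mult σ

/-- ★ the certified level of the TOP `−i` read at `G = −mult·K`: `L_Ti = mult·(1 − σ)·Im K`. -/
theorem lcert_topI (xv h : ℝ) (K : ℂ) (mult : ℕ) (σ : ℝ) : Lcert (topI xv h) (-((mult : ℂ) * K)) σ = mult * ((1 - σ) * K.im) := by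
  unfold topI
  rw [lcert_oneCut, map_neg, Complex.conj_I, neg_neg]
  simp only [Complex.neg_re, Complex.neg_im, Complex.mul_re, Complex.mul_im, Complex.I_re, Complex.I_im, Complex.natCast_re,
    Complex.natCast_im, zero_mul, one_mul, sub_zero, zero_sub, add_zero]
  ring

/-- the numerator of the TOP `−i` read is a difference of two `c`'s: `N_Ti(u) = c_w(u) − c_{p₁}(u)` (`c = farPairC`). -/
theorem cutNumer_topI (xv h : ℝ) (w u : ℂ) : cutNumer (topI xv h) w u = farPairC w u - farPairC ⟨xv, h⟩ u := by
  unfold topI farPairC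
  rw [cutNumer_oneCut, map_neg, Complex.conj_I, neg_neg, Complex.mul_re, Complex.I_re, Complex.I_im, Complex.sub_im]
  ring

/-- the datum kernel is NONZERO for a child strictly between the real axis and the parent's height (the numerator has imaginary part `2·Im w`). -/
theorem farPairK_ne_zero {v w : ℂ} (ht : 0 < w.im) (htY : w.im < v.im) : farPairK v w ≠ 0 := by
  have h1 : w - v ≠ 0 := sub_ne_zero.2 (by rintro rfl; exact lt_irrefl _ htY)
  have h2 : w - conj v ≠ 0 := sub_ne_zero.2 fun h0 => by
    have := congrArg Complex.im h0
    rw [Complex.conj_im] at this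
    linarith
  unfold farPairK
  rw [div_add_div _ _ h1 h2, one_mul, mul_one]
  refine div_ne_zero (fun h0 => ?_) (mul_ne_zero h1 h2)
  have := congrArg Complex.im h0
  rw [Complex.add_im, Complex.sub_im, Complex.sub_im, Complex.conj_im, Complex.zero_im] at this
  linarith

/-- kernel domination on the thin strip is ANTITONE in the lid height: a lid at `Hs'` serves every `Hs ≤ Hs'`. -/
theorem kernelDomThin_anti {κ : Type} [Fintype κ] {xv R Hs Hs' : ℝ} {cs : κ → Cut} {w : ℂ} {σ : ℝ} (hle : Hs ≤ Hs')
    (hK : KernelDomThin xv R Hs' cs w σ) : KernelDomThin xv R Hs cs w σ :=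
  fun u hu => hK u ⟨hu.1, hu.2.trans hle⟩

/-! ## §2 The menu law (OPEN) and its links to the thin certificate claims -/

/-- menu member A CERTIFIES the datum with multiplier `σ`: (K∂_thin) for the rule-A foot read on the boundary of the thin strip of lid `Hs`, and (D). -/
def FootACert (lam xv R s Hs : ℝ) (v w : ℂ) (mult : ℕ) (σ : ℝ) : Prop :=
  KernelDomThinBdry xv R Hs (footA xv v w) w σ ∧ DatumAlt lam s ‖farPairK v w‖ (footA xv v w) (-((mult : ℂ) * farPairK v w)) σ

/-- menu member Ti CERTIFIES the datum with multiplier `σ`: (K∂_thin) for the top `−i` read, and (D). -/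
def TopICert (lam xv R s h Hs : ℝ) (v w : ℂ) (mult : ℕ) (σ : ℝ) : Prop :=
  KernelDomThinBdry xv R Hs (topI xv h) w σ ∧ DatumAlt lam s ‖farPairK v w‖ (topI xv h) (-((mult : ℂ) * farPairK v w)) σ

/-- THE MENU LAW for exponent `lam` (OPEN; conjecture-shaped; E5 of the β′ edit list (CA1117): numerically `lam² = 5/4`, floor `+0.107` bulk, `+6` near-axis
corner — C3 g58 RESULT-2, which proves nothing here): for every legal thin datum — the binders of C1's `CertificatesExistThinSig` VERBATIM except that the lid
is read at its MAXIMAL height `Hs := R/2 − h` of E1′ (`2·(Hs + h) ≤ R`; smaller lids follow, `kernelDomThin_anti`) — ONE of the two datum-determined one-cut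
reads {A = rule-A foot, Ti = top `−i`} certifies (K∂_thin) ∧ (D) for SOME multiplier `σ` (numerically `σ_X = sup_∂ N_X/c`; (K∂) is monotone and (D) antitone
in `σ`, `Im K ≥ 0` for nested data, so `∃ σ` is the typed form of the sup). -/
def MenuThinSig (lam : ℝ) : Prop :=
  ∀ (xv R s h : ℝ) (v w : ℂ) (mult : ℕ),
    0 < s → 2 * s ≤ h → 3 * h < R → v.re = xv → 0 < v.im → v.im ≤ h →
    0 < w.im → w.im < v.im → v.im - s / 4 < w.im → (w.re - xv) ^ 2 + w.im ^ 2 ≤ v.im ^ 2 → 1 ≤ mult →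
    (∃ σ : ℝ, FootACert lam xv R s (R / 2 - h) v w mult σ) ∨ (∃ σ : ℝ, TopICert lam xv R s h (R / 2 - h) v w mult σ)

/-- the menu law RESTRICTED to right children `xv ≤ Re w` (what «rh33346-thincert» scans; left children by reflection on the consumer side, `thinMirrorSig`). -/
def MenuThinRightSig (lam : ℝ) : Prop :=
  ∀ (xv R s h : ℝ) (v w : ℂ) (mult : ℕ),
    0 < s → 2 * s ≤ h → 3 * h < R → v.re = xv → 0 < v.im → v.im ≤ h →
    0 < w.im → w.im < v.im → v.im - s / 4 < w.im → (w.re - xv) ^ 2 + w.im ^ 2 ≤ v.im ^ 2 → 1 ≤ mult → xv ≤ w.re →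
    (∃ σ : ℝ, FootACert lam xv R s (R / 2 - h) v w mult σ) ∨ (∃ σ : ℝ, TopICert lam xv R s h (R / 2 - h) v w mult σ)

/-- the all-children menu law implies the right-children menu law (drop the binder `xv ≤ Re w`). -/
theorem menuThinRightSig_of_menu {lam : ℝ} (hM : MenuThinSig lam) : MenuThinRightSig lam :=
  fun xv R s h v w mult hs hsh h3 hv hY hYh ht htY hdrop hnest hmult _ => hM xv R s h v w mult hs hsh h3 hv hY hYh ht htY hdrop hnest hmult

/-- ★ THE WITNESS: for one legal datum, a certifying menu member at the maximal lid and thin Lemma H give the `n = 1` certificate C1's claims ask for, at every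
lid `Hs ≤ R/2 − h` (reading points ON the axis; the child in the near window by nesting and `3h < R`; (K∂) → (K) by Lemma H; the lid by antitonicity). -/
theorem thin_certificate_of_menu {lam xv R s h Hs : ℝ} {v w : ℂ} {mult : ℕ} (hH : LemmaHThinSig) (hs : 0 < s) (hsh : 2 * s ≤ h) (h3 : 3 * h < R)
    (hHR : 2 * (Hs + h) ≤ R) (hY : 0 < v.im) (hYh : v.im ≤ h) (ht : 0 < w.im) (htY : w.im < v.im) (hnest : (w.re - xv) ^ 2 + w.im ^ 2 ≤ v.im ^ 2)
    (hcert : (∃ σ : ℝ, FootACert lam xv R s (R / 2 - h) v w mult σ) ∨ (∃ σ : ℝ, TopICert lam xv R s h (R / 2 - h) v w mult σ)) :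
    ∃ (n : ℕ) (cs : Fin n → Cut) (σ : ℝ), CutsAdmissible xv cs ∧ (∀ k, (cs k).p = ⟨xv, w.im⟩ ∨ (cs k).p = ⟨xv, h⟩) ∧
      KernelDomThin xv R Hs cs w σ ∧ DatumAlt lam s ‖farPairK v w‖ cs (-((mult : ℂ) * farPairK v w)) σ := by
  have hle : Hs ≤ R / 2 - h := by linarith
  have hw : |w.re - xv| < R / 2 := abs_re_lt_of_nested h3 hY.le hYh hnest
  have hR2 : 0 < R / 2 := by linarith
  have hp : ∀ (p e : ℂ), p.re = xv → ∀ k, |(oneCut p e k).p.re - xv| < R / 2 := fun p e hpx k => by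
    rw [oneCut_p, hpx, sub_self, abs_zero]; exact hR2
  rcases hcert with ⟨σ, hK, hD⟩ | ⟨σ, hK, hD⟩
  · exact ⟨1, footA xv v w, σ, oneCut_admissible rfl (norm_ruleADir (farPairK_ne_zero ht htY)), footA_pts xv h v w,
      kernelDomThin_anti hle (hH (Fin 1) xv R (R / 2 - h) _ w σ hw (hp _ _ rfl) hK), hD⟩
  · exact ⟨1, topI xv h, σ, oneCut_admissible rfl (by rw [norm_neg, Complex.norm_I]), topI_pts xv h w,
      kernelDomThin_anti hle (hH (Fin 1) xv R (R / 2 - h) _ w σ hw (hp _ _ rfl) hK), hD⟩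

/-- ★★ LINK: thin Lemma H and the MENU LAW give C1's thin certificate claim `CertificatesExistThinSig lam` (E2 text of record). -/
theorem certificatesExistThinSig_of_menu {lam : ℝ} (hH : LemmaHThinSig) (hM : MenuThinSig lam) : CertificatesExistThinSig lam :=
  fun xv R s h _Hs v w mult hs hsh h3 _ hHR hv hY hYh ht htY hdrop hnest hmult =>
    thin_certificate_of_menu hH hs hsh h3 hHR hY hYh ht htY hnest (hM xv R s h v w mult hs hsh h3 hv hY hYh ht htY hdrop hnest hmult)

/-- ★★ LINK, right children: thin Lemma H and the RIGHT menu law give C1's `CertificatesExistRightThinSig lam` (all children then by `thinMirrorSig`). -/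
theorem certificatesExistRightThinSig_of_menuRight {lam : ℝ} (hH : LemmaHThinSig) (hM : MenuThinRightSig lam) :
    CertificatesExistRightThinSig lam :=
  fun xv R s h _Hs v w mult hs hsh h3 _ hHR hv hY hYh ht htY hdrop hnest hmult hright =>
    thin_certificate_of_menu hH hs hsh h3 hHR hY hYh ht htY hnest (hM xv R s h v w mult hs hsh h3 hv hY hYh ht htY hdrop hnest hmult hright)

/-- ★★ the RIGHT menu law alone gives E2's FULL thin law (left children by C1's mirror `RhW08.SinkThin.thinMirrorSig`, «SinkThinSig»). -/
theorem certificatesExistThinSig_of_menuRight {lam : ℝ} (hH : LemmaHThinSig) (hM : MenuThinRightSig lam) : CertificatesExistThinSig lam :=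
  thinMirrorSig lam (certificatesExistRightThinSig_of_menuRight hH hM)

/-! ## §3 The menu law as a statement about real rational functions -/

/-- `Im K_u(z)` in 110's coordinates: `−pairCForm (Re z − xv) (Im z) (Re u − xv) (Im u)`. -/
theorem farPairK_im (u z : ℂ) (xv : ℝ) : (farPairK u z).im = -pairCForm (z.re - xv) z.im (u.re - xv) u.im := by
  have h := farPairC_eq z u xv; unfold farPairC at h; linarith

/-- CLOSED FORMS of the datum kernel `K = K_v(w)`, `v = xv + i·Y`, `w = xv + δ + i·t`: `Re K`, `Im K` (`Im K ≥ 0` iff `δ² + t² ≤ Y²`) and `‖K‖`. -/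
def kerRe (δ t Y : ℝ) : ℝ := pairReForm δ t 0 Y
/-- `Im K_v(w)` in datum coordinates (`≥ 0` iff `δ² + t² ≤ Y²`). -/
def kerIm (δ t Y : ℝ) : ℝ := -pairCForm δ t 0 Y
/-- `‖K_v(w)‖` in datum coordinates. -/
def kerNorm (δ t Y : ℝ) : ℝ := Real.sqrt (kerRe δ t Y ^ 2 + kerIm δ t Y ^ 2)

/-- `Re K_v(w)` in datum coordinates. -/
theorem farPairK_re_datum {xv : ℝ} {v : ℂ} (hv : v.re = xv) (w : ℂ) : (farPairK v w).re = kerRe (w.re - xv) w.im v.im := by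
  rw [kerRe, farPairK_re v w xv, hv, sub_self]
/-- `Im K_v(w)` in datum coordinates. -/
theorem farPairK_im_datum {xv : ℝ} {v : ℂ} (hv : v.re = xv) (w : ℂ) : (farPairK v w).im = kerIm (w.re - xv) w.im v.im := by
  rw [kerIm, farPairK_im v w xv, hv, sub_self]

/-- `‖K_v(w)‖` in datum coordinates. -/
theorem norm_farPairK_datum {xv : ℝ} {v : ℂ} (hv : v.re = xv) (w : ℂ) : ‖farPairK v w‖ = kerNorm (w.re - xv) w.im v.im := by
  rw [kerNorm, ← farPairK_re_datum hv, ← farPairK_im_datum hv, ← Complex.normSq_add_mul_I]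
  rw [Complex.re_add_im, ← Complex.sq_norm, Real.sqrt_sq (norm_nonneg _)]

/-- CLOSED FORM of the rule-A foot numerator `N_A(u) = Re(conj e_A · (K_u(w) − K_u(p₀)))` (C3 `menu2.py`: `ca·Re a + sa·Im a`, `ca = −Re K/‖K‖`,
`sa = −Im K/‖K‖`). -/
def footANumForm (δ t Y ξ b : ℝ) : ℝ :=
  -((kerRe δ t Y * (pairReForm δ t ξ b - pairReForm 0 t ξ b) + kerIm δ t Y * (pairCForm 0 t ξ b - pairCForm δ t ξ b)) / kerNorm δ t Y)

/-- CLOSED FORM of the top `−i` numerator `N_Ti(u) = c_w(u) − c_{p₁}(u)`. -/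
def topINumForm (δ t h ξ b : ℝ) : ℝ := pairCForm δ t ξ b - pairCForm 0 h ξ b

/-- the cut numerator of member A is `footANumForm` in datum/boundary coordinates. -/
theorem cutNumer_footA {xv : ℝ} {v : ℂ} (hv : v.re = xv) (w u : ℂ) :
    cutNumer (footA xv v w) w u = footANumForm (w.re - xv) w.im v.im (u.re - xv) u.im := by
  unfold footA footANumForm
  rw [cutNumer_oneCut, conj_ruleADir_mul_re, Complex.sub_re, Complex.sub_im, farPairK_re u w xv, farPairK_re u ⟨xv, w.im⟩ xv,
    farPairK_im u w xv, farPairK_im u ⟨xv, w.im⟩ xv, farPairK_re_datum hv, farPairK_im_datum hv, norm_farPairK_datum hv]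
  simp only [sub_self]
  ring

/-- the cut numerator of member Ti is `topINumForm` in datum/boundary coordinates. -/
theorem cutNumer_topI_form (xv h : ℝ) (w u : ℂ) : cutNumer (topI xv h) w u = topINumForm (w.re - xv) w.im h (u.re - xv) u.im := by
  rw [cutNumer_topI, topINumForm, farPairC_eq w u xv, farPairC_eq ⟨xv, h⟩ u xv]; simp only [sub_self]

/-- (K∂_thin) for ANY cut family ⇔ four one-real-variable families of inequalities: right / left column `u = xv ± R/2 + i b`, `0 ≤ b ≤ Hs`, and right / left lid
ray `u = xv + ξ + i Hs`, `R/2 ≤ ±ξ` (the lower halves by `K_{ū} = K_u`; `0 ≤ R`, `0 ≤ Hs`) — 110's `kernelDomBdry_iff` with the lid at `Hs`. -/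
theorem kernelDomThinBdry_iff {κ : Type} [Fintype κ] (xv R Hs : ℝ) (hR : 0 ≤ R) (hHs : 0 ≤ Hs) (cs : κ → Cut) (w : ℂ) (σ : ℝ) :
    KernelDomThinBdry xv R Hs cs w σ ↔
      (∀ b : ℝ, 0 ≤ b → b ≤ Hs → cutNumer cs w ⟨xv + R / 2, b⟩ ≤ σ * farPairC w ⟨xv + R / 2, b⟩) ∧
      (∀ b : ℝ, 0 ≤ b → b ≤ Hs → cutNumer cs w ⟨xv - R / 2, b⟩ ≤ σ * farPairC w ⟨xv - R / 2, b⟩) ∧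
      (∀ ξ : ℝ, R / 2 ≤ ξ → cutNumer cs w ⟨xv + ξ, Hs⟩ ≤ σ * farPairC w ⟨xv + ξ, Hs⟩) ∧
      (∀ ξ : ℝ, R / 2 ≤ -ξ → cutNumer cs w ⟨xv + ξ, Hs⟩ ≤ σ * farPairC w ⟨xv + ξ, Hs⟩) := by
  have hR2 : 0 ≤ R / 2 := by linarith
  have hcol : ∀ b : ℝ, 0 ≤ b → b ≤ Hs → |b| ≤ Hs := fun b hb0 hb1 => abs_le.2 ⟨by linarith, hb1⟩
  have e1 : |xv + R / 2 - xv| = R / 2 := by rw [add_sub_cancel_left, abs_of_nonneg hR2]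
  have e2 : |xv - R / 2 - xv| = R / 2 := by rw [sub_sub_cancel_left, abs_neg, abs_of_nonneg hR2]
  have e3 : ∀ ξ : ℝ, |xv + ξ - xv| = |ξ| := fun ξ => by rw [add_sub_cancel_left]
  constructor
  · intro hK
    exact ⟨fun b hb0 hb1 => hK _ (Or.inl ⟨e1, hcol b hb0 hb1⟩), fun b hb0 hb1 => hK _ (Or.inl ⟨e2, hcol b hb0 hb1⟩),
      fun ξ hξ => hK _ (Or.inr ⟨(le_abs.2 (Or.inl hξ)).trans_eq (e3 ξ).symm, abs_of_nonneg hHs⟩),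
      fun ξ hξ => hK _ (Or.inr ⟨(le_abs.2 (Or.inr hξ)).trans_eq (e3 ξ).symm, abs_of_nonneg hHs⟩)⟩
  · rintro ⟨hC1, hC2, hL1, hL2⟩
    have key : ∀ u : ℂ, 0 ≤ u.im → ThinStripBdry xv R Hs u → cutNumer cs w u ≤ σ * farPairC w u := by
      intro u hu hB
      rcases hB with ⟨h1, h2⟩ | ⟨h1, h2⟩
      · have hb : u.im ≤ Hs := (abs_le.1 h2).2
        rcases (abs_eq hR2).1 h1 with h | h
        · have e : u = ⟨xv + R / 2, u.im⟩ := Complex.ext (by simp; linarith) (by simp)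
          rw [e]
          exact hC1 u.im hu hb
        · have e : u = ⟨xv - R / 2, u.im⟩ := Complex.ext (by simp; linarith) (by simp)
          rw [e]
          exact hC2 u.im hu hb
      · have hb : u.im = Hs := by rw [← h2, abs_of_nonneg hu]
        have e : u = ⟨xv + (u.re - xv), Hs⟩ := Complex.ext (by simp) (by simp [hb])
        rcases le_abs.1 h1 with h | h
        · rw [e]
          exact hL1 (u.re - xv) h
        · rw [e]
          exact hL2 (u.re - xv) h
    intro u hB
    rcases le_or_gt 0 u.im with hu | hu
    · exact key u hu hB
    · have hu' : 0 ≤ (conj u).im := by rw [Complex.conj_im]; linarith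
      have hB' : ThinStripBdry xv R Hs (conj u) := by
        unfold ThinStripBdry at hB ⊢
        rw [Complex.conj_re, Complex.conj_im, abs_neg]
        exact hB
      have := key (conj u) hu' hB'
      rwa [cutNumer_conj, farPairC_conj] at this

/-- (K∂_thin) for the rule-A foot read IN CLOSED FORM (window `R`, lid `Hs`, child `(δ, t)`, parent height `Y`, multiplier `σ`). -/
def ThinBdryDomFormA (R Hs δ t Y σ : ℝ) : Prop :=
  (∀ b : ℝ, 0 ≤ b → b ≤ Hs → footANumForm δ t Y (R / 2) b ≤ σ * pairCForm δ t (R / 2) b) ∧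
  (∀ b : ℝ, 0 ≤ b → b ≤ Hs → footANumForm δ t Y (-(R / 2)) b ≤ σ * pairCForm δ t (-(R / 2)) b) ∧
  (∀ ξ : ℝ, R / 2 ≤ ξ → footANumForm δ t Y ξ Hs ≤ σ * pairCForm δ t ξ Hs) ∧
  (∀ ξ : ℝ, R / 2 ≤ -ξ → footANumForm δ t Y ξ Hs ≤ σ * pairCForm δ t ξ Hs)
/-- (K∂_thin) for the top `−i` read IN CLOSED FORM (window `R`, lid `Hs`, box top `h`, child `(δ, t)`, multiplier `σ`). -/
def ThinBdryDomFormTi (R Hs h δ t σ : ℝ) : Prop :=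
  (∀ b : ℝ, 0 ≤ b → b ≤ Hs → topINumForm δ t h (R / 2) b ≤ σ * pairCForm δ t (R / 2) b) ∧
  (∀ b : ℝ, 0 ≤ b → b ≤ Hs → topINumForm δ t h (-(R / 2)) b ≤ σ * pairCForm δ t (-(R / 2)) b) ∧
  (∀ ξ : ℝ, R / 2 ≤ ξ → topINumForm δ t h ξ Hs ≤ σ * pairCForm δ t ξ Hs) ∧
  (∀ ξ : ℝ, R / 2 ≤ -ξ → topINumForm δ t h ξ Hs ≤ σ * pairCForm δ t ξ Hs)
/-- (D) for the rule-A foot read IN CLOSED FORM (the case `mult = 1`): `‖K‖/lam ≤ ‖K‖ − σ·Im K ∨ 1/(2s) < ‖K‖ − σ·Im K`. -/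
def AltFormA (lam s δ t Y σ : ℝ) : Prop :=
  kerNorm δ t Y / lam ≤ kerNorm δ t Y - σ * kerIm δ t Y ∨ 1 / (2 * s) < kerNorm δ t Y - σ * kerIm δ t Y
/-- (D) for the top `−i` read IN CLOSED FORM (the case `mult = 1`): `‖K‖/lam ≤ (1 − σ)·Im K ∨ 1/(2s) < (1 − σ)·Im K`. -/
def AltFormTi (lam s δ t Y σ : ℝ) : Prop :=
  kerNorm δ t Y / lam ≤ (1 - σ) * kerIm δ t Y ∨ 1 / (2 * s) < (1 - σ) * kerIm δ t Y
/-- (K∂_thin) for member A ⇔ its closed form `ThinBdryDomFormA`. -/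
theorem kernelDomThinBdry_footA_iff {xv : ℝ} {v : ℂ} (hv : v.re = xv) (R Hs : ℝ) (hR : 0 ≤ R) (hHs : 0 ≤ Hs) (w : ℂ) (σ : ℝ) :
    KernelDomThinBdry xv R Hs (footA xv v w) w σ ↔ ThinBdryDomFormA R Hs (w.re - xv) w.im v.im σ := by
  rw [kernelDomThinBdry_iff xv R Hs hR hHs]
  unfold ThinBdryDomFormA
  simp only [cutNumer_footA hv, farPairC_eq w _ xv, add_sub_cancel_left, sub_sub_cancel_left]
/-- (K∂_thin) for member Ti ⇔ its closed form `ThinBdryDomFormTi`. -/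
theorem kernelDomThinBdry_topI_iff (xv R Hs h : ℝ) (hR : 0 ≤ R) (hHs : 0 ≤ Hs) (w : ℂ) (σ : ℝ) :
    KernelDomThinBdry xv R Hs (topI xv h) w σ ↔ ThinBdryDomFormTi R Hs h (w.re - xv) w.im σ := by
  rw [kernelDomThinBdry_iff xv R Hs hR hHs]
  unfold ThinBdryDomFormTi
  simp only [cutNumer_topI_form, farPairC_eq w _ xv, add_sub_cancel_left, sub_sub_cancel_left]
/-- (D) FOR EVERY MULTIPLICITY ⇔ ONE REAL ALTERNATIVE, for ANY cut family whose certified level at `G = −mult·K` is `mult·B`: `gnorm/lam ≤ B ∨ 1/(2s) < B`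
(the case `mult = 1`; `0 < lam`, `0 < s`, `0 ≤ gnorm`; either disjunct makes `B ≥ 0` resp. `> 0`, then `mult·B ≥ B`) — 142's two-point lemma made generic. -/
theorem datumAlt_forall_mult_iff_of_lcert {κ : Type} [Fintype κ] {lam s gnorm B : ℝ} (hlam : 0 < lam) (hs : 0 < s) (hg : 0 ≤ gnorm)
    {cs : κ → Cut} {K : ℂ} {σ : ℝ} (hL : ∀ mult : ℕ, Lcert cs (-((mult : ℂ) * K)) σ = mult * B) :
    (∀ mult : ℕ, 1 ≤ mult → DatumAlt lam s gnorm cs (-((mult : ℂ) * K)) σ) ↔ (gnorm / lam ≤ B ∨ 1 / (2 * s) < B) := by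
  unfold DatumAlt
  constructor
  · intro h
    have h1 := h 1 le_rfl
    rwa [hL, Nat.cast_one, one_mul] at h1
  · intro h mult hmult
    rw [hL]
    have hm : (1 : ℝ) ≤ mult := by exact_mod_cast hmult
    have hK0 : 0 ≤ gnorm / lam := div_nonneg hg hlam.le
    rcases h with h | h
    · have hB : 0 ≤ B := hK0.trans h
      left; nlinarith
    · have hB : 0 < B := lt_trans (by positivity) h
      right; nlinarith
/-- (D) for the rule-A foot read for EVERY multiplicity `mult ≥ 1` ⇔ `AltFormA` (`0 < lam`, `0 < s`). -/
theorem datumAlt_footA_forall_mult_iff {lam s xv : ℝ} (hlam : 0 < lam) (hs : 0 < s) {v : ℂ} (hv : v.re = xv) (w : ℂ) (σ : ℝ) :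
    (∀ mult : ℕ, 1 ≤ mult → DatumAlt lam s ‖farPairK v w‖ (footA xv v w) (-((mult : ℂ) * farPairK v w)) σ) ↔
      AltFormA lam s (w.re - xv) w.im v.im σ := by
  rw [AltFormA, ← farPairK_im_datum hv, ← norm_farPairK_datum hv]
  exact datumAlt_forall_mult_iff_of_lcert hlam hs (norm_nonneg _) (fun mult => lcert_footA xv v w mult σ)
/-- (D) for the top `−i` read for EVERY multiplicity `mult ≥ 1` ⇔ `AltFormTi`. -/
theorem datumAlt_topI_forall_mult_iff {lam s xv : ℝ} (hlam : 0 < lam) (hs : 0 < s) {v : ℂ} (hv : v.re = xv) (h : ℝ) (w : ℂ) (σ : ℝ) :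
    (∀ mult : ℕ, 1 ≤ mult → DatumAlt lam s ‖farPairK v w‖ (topI xv h) (-((mult : ℂ) * farPairK v w)) σ) ↔
      AltFormTi lam s (w.re - xv) w.im v.im σ := by
  rw [AltFormTi, ← farPairK_im_datum hv, ← norm_farPairK_datum hv]
  exact datumAlt_forall_mult_iff_of_lcert hlam hs (norm_nonneg _) (fun mult => lcert_topI xv h (farPairK v w) mult σ)
/-- (D) for the rule-A foot read at `mult = 1` ⇔ `AltFormA`. -/
theorem datumAlt_footA_one_iff {lam s xv : ℝ} {v : ℂ} (hv : v.re = xv) (w : ℂ) (σ : ℝ) :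
    DatumAlt lam s ‖farPairK v w‖ (footA xv v w) (-(((1 : ℕ) : ℂ) * farPairK v w)) σ ↔ AltFormA lam s (w.re - xv) w.im v.im σ := by
  unfold DatumAlt AltFormA
  rw [lcert_footA, Nat.cast_one, one_mul, farPairK_im_datum hv, norm_farPairK_datum hv]
/-- (D) for the top `−i` read at `mult = 1` ⇔ `AltFormTi`. -/
theorem datumAlt_topI_one_iff {lam s xv : ℝ} {v : ℂ} (hv : v.re = xv) (h : ℝ) (w : ℂ) (σ : ℝ) :
    DatumAlt lam s ‖farPairK v w‖ (topI xv h) (-(((1 : ℕ) : ℂ) * farPairK v w)) σ ↔ AltFormTi lam s (w.re - xv) w.im v.im σ := by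
  unfold DatumAlt AltFormTi
  rw [lcert_topI, Nat.cast_one, one_mul, farPairK_im_datum hv, norm_farPairK_datum hv]
/-- the per-datum menu disjunction, model ⇔ real form (EVERY `mult ≥ 1` at once on the model side; `0 < lam`, `0 < s`, `2s ≤ h`, `3h < R`). -/
theorem menu_datum_iff {lam s xv R h : ℝ} (hlam : 0 < lam) (hs : 0 < s) (hsh : 2 * s ≤ h) (h3 : 3 * h < R) {v : ℂ} (hv : v.re = xv) (w : ℂ) :
    (∀ mult : ℕ, 1 ≤ mult →
      ((∃ σ : ℝ, FootACert lam xv R s (R / 2 - h) v w mult σ) ∨ (∃ σ : ℝ, TopICert lam xv R s h (R / 2 - h) v w mult σ))) ↔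
    ((∃ σ : ℝ, ThinBdryDomFormA R (R / 2 - h) (w.re - xv) w.im v.im σ ∧ AltFormA lam s (w.re - xv) w.im v.im σ) ∨
     (∃ σ : ℝ, ThinBdryDomFormTi R (R / 2 - h) h (w.re - xv) w.im σ ∧ AltFormTi lam s (w.re - xv) w.im v.im σ)) := by
  have hR : 0 ≤ R := by linarith
  have hHs : 0 ≤ R / 2 - h := by linarith
  constructor
  · intro hh
    rcases hh 1 le_rfl with ⟨σ, hK, hD⟩ | ⟨σ, hK, hD⟩
    · exact Or.inl ⟨σ, (kernelDomThinBdry_footA_iff hv R _ hR hHs w σ).1 hK, (datumAlt_footA_one_iff hv w σ).1 hD⟩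
    · exact Or.inr ⟨σ, (kernelDomThinBdry_topI_iff xv R _ h hR hHs w σ).1 hK, (datumAlt_topI_one_iff hv h w σ).1 hD⟩
  · intro hh mult hmult
    rcases hh with ⟨σ, hK, hD⟩ | ⟨σ, hK, hD⟩
    · exact Or.inl ⟨σ, (kernelDomThinBdry_footA_iff hv R _ hR hHs w σ).2 hK,
        (datumAlt_footA_forall_mult_iff hlam hs hv w σ).2 hD mult hmult⟩
    · exact Or.inr ⟨σ, (kernelDomThinBdry_topI_iff xv R _ h hR hHs w σ).2 hK,
        (datumAlt_topI_forall_mult_iff hlam hs hv h w σ).2 hD mult hmult⟩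
/-- THE RIGHT MENU LAW AS A STATEMENT ABOUT REAL RATIONAL FUNCTIONS (⇔ `MenuThinRightSig lam` for `0 < lam`, `menuThinRightSig_iff`; the text «rh33346-thincert»
addresses at `lam² = 5/4` in the `R = 2` normal form): binders window `R`, scale `s`, box top `h`, child offset `0 ≤ δ` and height `t`, parent height `Y`. -/
def MenuThinRightRealSig (lam : ℝ) : Prop :=
  ∀ (R s h δ t Y : ℝ),
    0 < s → 2 * s ≤ h → 3 * h < R → 0 < Y → Y ≤ h → 0 < t → t < Y → Y - s / 4 < t → δ ^ 2 + t ^ 2 ≤ Y ^ 2 → 0 ≤ δ →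
    (∃ σ : ℝ, ThinBdryDomFormA R (R / 2 - h) δ t Y σ ∧ AltFormA lam s δ t Y σ) ∨
    (∃ σ : ℝ, ThinBdryDomFormTi R (R / 2 - h) h δ t σ ∧ AltFormTi lam s δ t Y σ)
/-- ★ THE RIGHT MENU LAW ⇔ ITS REAL CLOSED FORM (`0 < lam`). -/
theorem menuThinRightSig_iff {lam : ℝ} (hlam : 0 < lam) : MenuThinRightSig lam ↔ MenuThinRightRealSig lam := by
  constructor
  · intro hM R s h δ t Y hs hsh h3 hY hYh ht htY hdrop hnest hδ
    have key := (menu_datum_iff hlam hs hsh h3 (rfl : (⟨0, Y⟩ : ℂ).re = 0) ⟨δ, t⟩).1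
      (fun mult hmult => hM 0 R s h ⟨0, Y⟩ ⟨δ, t⟩ mult hs hsh h3 rfl hY hYh ht htY hdrop (by simpa using hnest) hmult (by simpa using hδ))
    simpa using key
  · intro hReal xv R s h v w mult hs hsh h3 hv hY hYh ht htY hdrop hnest hmult hright
    exact (menu_datum_iff hlam hs hsh h3 hv w).2
      (hReal R s h (w.re - xv) w.im v.im hs hsh h3 hY hYh ht htY hdrop hnest (sub_nonneg.2 hright)) mult hmult
/-- NON-VACUITY of the binders: legal right thin data exist (`R = 4`, `s = 1/2`, `h = Y = 1`, `t = 15/16`, `δ = 0`). -/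
theorem menu_binders_inhabited : ∃ (R s h δ t Y : ℝ),
    0 < s ∧ 2 * s ≤ h ∧ 3 * h < R ∧ 0 < Y ∧ Y ≤ h ∧ 0 < t ∧ t < Y ∧ Y - s / 4 < t ∧ δ ^ 2 + t ^ 2 ≤ Y ^ 2 ∧ 0 ≤ δ :=
  ⟨4, 1 / 2, 1, 0, 15 / 16, 1, by norm_num⟩

end RhW08.MenuThin
end
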